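import Mathlib
import Summits.NavierStokesRegularity.NavierStokesRegularity.Theorems.FilamentSkeletonRssSkeletonJ1RLiaDefectDerivSelfArith
import Summits.NavierStokesRegularity.NavierStokesRegularity.Theorems.FilamentSkeletonRssSkeletonJ1RLiaDefectDerivSelfWindow
import Summits.NavierStokesRegularity.NavierStokesRegularity.Theorems.FilamentSkeletonRssSkeletonJ1RLiaSelfDerivReference
import Summits.NavierStokesRegularity.NavierStokesRegularity.Theorems.FilamentSkeletonRssSkeletonJ1RLiaDerivBookkeepingTools

/-!
# Crux `SkeletonJ1R` (stmt-NavierStokesRegularity-23610) · line `streamline_kantorovich_R` · stub F2-d (`LiaDefectDerivBL`, v7) — Γ-BOOKKEEPING BRICK B1′: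
# on the collar, `ℓ ×` the self-strand term of the DERIVATIVE of the defect residual is `O((√Γ + |τ|)/√log Γ)`, constants uniform in the datum class

Hand `leafhand-ns-filamentskeletonrs-1` (gen 1), `--supports stmt-NavierStokesRegularity-23610 --as helper`.  MODEL rung, NEGATIVE side of the ladder:
estimates for a HYPOTHETICAL filament-type blow-up skeleton; nothing here is a claim about Navier–Stokes regularity; the stub and the crux stay OPEN.

`selfDerivTerm_bound` — the derivative analogue of B1 (`…LiaDefectSelfBound.selfTerm_bound`, whose parameter choices it copies: window `R = r₀√Γ`,
`r₀ = e·exp 1/2`, outer window `Lw = R + 2ℓ`, envelope `ε₀ = b e₀√Γ`, `ε₁ = b Q₀`, `κ_R = b kR (√Γ+|τ|)`, `κ₀ = b(e₀+Q₀)(√Γ+|τ|)`, `θ = 2θ₁`,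
`b = 8π/(θp Γ log Γ) ≥ |β⁻¹|`, `log Γ ≥ max 4 δ₀²`): for the class constants there are `Cself, Lmin` such that on the collar
`ℓ² ≤ ‖x_jτ‖² ≤ 2ℓ²`, `|τ| ≤ 3ℓ`,
`ℓ · ‖(Γγ_j/4π) • Ȧ_j(τ) − β • (x_j′ × (β⁻¹(x_j″ × W + x_j′ × DW·x_j′)) + x_j″ × x_j″)‖ ≤ Cself · (√Γ + |τ|)/√(log Γ)`,
`Ȧ_j` the fixed-`σ` derivative-kernel self strand.  Proof: on the closed switched region the `V`-term is `x_j′ × x_j‴` (`…LiaDerivBookkeepingTools.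
thirdDerivForm_eq_of_sq_le`, `x″ × x″ = 0`); brick S4′ (`…LiaSelfDerivReference.IsLiaReference.selfDerivStrand_sub_lia_le`) with the window data
`H = b·hH`, `H′ = b·h′/√Γ` of `…LiaDefectDerivSelfWindow.thirdDeriv_window_ceilings`; the Rosenhead coefficient `Λ_e(R) = ½log Γ + O(e²/R²)` against
`liaCoeff`; and the eight resulting terms are booked by `…LiaDefectDerivSelfArith.selfDerivTerm_T1…T8` (the collar floor `ℓ ≤ (Rwd+1)(√Γ+|τ|)` pays the
window-logarithm term).  What remains for F2-d after this file: the 40-line assembly `hself` of `…LiaDefectDerivPartner.liaDefectDerivBL_of_self_deriv_bound`. [folklore]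
-/

-- `dupNamespace` off: the module name repeats `NavierStokesRegularity` by the tree's `Summits/<S>/<S>/Theorems` layout (same as every sibling file).
set_option linter.dupNamespace false
-- `unusedTactic`/`unreachableTactic` off: the `first | (field_simp; ring) | field_simp` closers below are robust to how far `field_simp` normalises.
set_option linter.unusedTactic false
set_option linter.unreachableTactic false

noncomputable section

namespace Summit.NavierStokesRegularity.NavierStokesRegularity.Theorems.SkeletonJ1RFrame

open Set Function Filter Real Topology MeasureTheory
open Literature.Analysis.FluidPDE
open Summit.NavierStokesRegularity.NavierStokesRegularity.Theorems.SkeletonJ1RLiaSelf (abs_liaWindowCoeff_sub_log_le liaWindowCoeff_nonneg)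
open scoped InnerProductSpace BigOperators

set_option maxHeartbeats 2400000 in
/-- **On the collar, `ℓ ×` the self-strand term of the residual DERIVATIVE is `O((√Γ + |τ|)/√log Γ)`** (see the module docstring). [folklore] -/
theorem selfDerivTerm_bound (N : ℕ) {θp ρd Rwd Rb : ℝ} (hθp : 0 < θp) (hρ : 0 < ρd) (hRwd : 0 ≤ Rwd) (hRb : 0 < Rb) :
    ∃ Cself Lmin : ℝ, 0 ≤ Cself ∧ ∀ {Γ θg : ℝ} {p t : Fin N → EuclideanSpace ℝ (Fin 3)} {γ : Fin N → ℝ} {α : ℝ} {s₀ : Fin N → ℝ}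
      {x : Fin N → ℝ → EuclideanSpace ℝ (Fin 3)}, 1 < Γ → Lmin ≤ Real.log Γ → IsLiaReference Γ Rb p t γ α s₀ x → (∀ k, ‖t k‖ = 1) →
      0 < θg → θg ≤ 1 → (∀ j k, j ≠ k → |inner ℝ (t j) (t k)| ≤ 1 - θg) →
      (∀ j k, j ≠ k → ∀ a b : ℝ, ρd ≤ ‖(p j + a • t j) - (p k + b • t k)‖) →
      ∀ (j : Fin N) {θ₁ : ℝ}, 0 ≤ θ₁ → θ₁ ≤ 1 / 2 →
      (∀ k, k ≠ j → θ₁ ≤ min (Real.sqrt θg / 4) (θg * ρd / (16 * (‖(p j + s₀ j • t j) - (p k + s₀ k • t k)‖ + ρd)))) →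
      (∀ σ, ‖deriv (x j) σ - t j‖ ≤ Rb / 8) → Rb / 8 ≤ θ₁ → θp ≤ |γ j| → (∀ k, |γ k| ≤ θp⁻¹) → |α| ≤ θp⁻¹ →
      (∀ k, ‖p k + s₀ k • t k‖ ≤ Rwd) → ∀ {τ : ℝ}, |τ| ≤ 3 * Rb * Real.sqrt Γ * Real.sqrt (Real.log Γ) →
      (Rb * Real.sqrt (Γ * Real.log Γ)) ^ 2 ≤ ‖x j τ‖ ^ 2 → ‖x j τ‖ ^ 2 ≤ 2 * (Rb * Real.sqrt (Γ * Real.log Γ)) ^ 2 →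
      Rb * Real.sqrt (Γ * Real.log Γ) *
        ‖(Γ * γ j / (4 * Real.pi)) • (∫ σ : ℝ, ((-3 * ⟪x j τ - x j σ, deriv (x j) τ⟫_ℝ *
              ((‖x j τ - x j σ‖ ^ 2 + Real.exp (-(1 + Real.eulerMascheroniConstant - Real.log 2)) * (1:ℝ)) ^ (5 / 2 : ℝ))⁻¹) •
            cross (deriv (x j) σ) (x j τ - x j σ) +
          ((‖x j τ - x j σ‖ ^ 2 + Real.exp (-(1 + Real.eulerMascheroniConstant - Real.log 2)) * (1:ℝ)) ^ (3 / 2 : ℝ))⁻¹ •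
            cross (deriv (x j) σ) (deriv (x j) τ))) -
          liaCoeff Γ γ j • (cross (deriv (x j) τ) ((liaCoeff Γ γ j)⁻¹ • (cross (deriv (deriv (x j)) τ) (ambientField Γ p t γ α s₀ j (x j τ)) +
              cross (deriv (x j) τ) (fderiv ℝ (ambientField Γ p t γ α s₀ j) (x j τ) (deriv (x j) τ)))) +
            cross (deriv (deriv (x j)) τ) (deriv (deriv (x j)) τ))‖ ≤
        Cself * (Real.sqrt Γ + |τ|) / Real.sqrt (Real.log Γ) := by
  -- the universal constants
  set a₀ : ℝ := Real.exp (-(1 + Real.eulerMascheroniConstant - Real.log 2)) * (1:ℝ) with ha₀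
  have ha₀0 : 0 < a₀ := coreConst_pos
  set e : ℝ := Real.sqrt a₀ with he
  have he0 : 0 < e := Real.sqrt_pos.2 ha₀0
  have he2 : e ^ 2 = a₀ := Real.sq_sqrt ha₀0.le
  set r₀ : ℝ := e * Real.exp 1 / 2 with hr₀
  have hr₀0 : 0 < r₀ := by positivity
  -- the window ceilings of x‴ (brick S4′c)
  obtain ⟨hH, h', hhH0, hh'0, hwin⟩ := thirdDeriv_window_ceilings N hθp hρ hRwd hRb
  -- the datum-class constants
  set B₀ : ℝ := N / (Real.pi * θp * ρd) with hB₀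
  set Q₀ : ℝ := 1 / 2 + θp⁻¹ with hQ₀
  set e₀ : ℝ := B₀ + Q₀ * Rwd with he₀
  set kR : ℝ := e₀ + Q₀ * (1 + r₀) with hkR
  set cu : ℝ := 1 + 3 * Rb with hcu
  set Cs : ℝ := Rwd + 1 with hCs
  set km : ℝ := B₀ + 2 * Q₀ * Rb with hkm
  set κ : ℝ := 2 / θp ^ 2 with hκ
  set δ₀ : ℝ := 8 * Real.pi * kR * r₀ * cu / θp with hδ₀
  have hB₀0 : 0 ≤ B₀ := by positivity
  have hQ₀0 : 0 < Q₀ := by positivity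
  have he₀0 : 0 ≤ e₀ := by positivity
  have hkR0 : 0 < kR := by positivity
  have hcu0 : 0 < cu := by positivity
  have hCs0 : 0 < Cs := by positivity
  have hkm0 : 0 ≤ km := by positivity
  have hκpos : 0 < κ := by positivity
  have hδ₀0 : 0 < δ₀ := by positivity
  -- the constant
  set Cself : ℝ := κ * (16 * r₀ * Rb * h') + κ * (1344 * Real.pi * r₀ * Rb * kR * hH / θp) + κ * (8 * δ₀ ^ 2 * hH * Rb) +
      κ * (144 * Q₀ * Rb * Cs / r₀) + κ * (72 * Real.pi * Rb * (e₀ + Q₀) / r₀) + 4 / (θp * Rb) + κ * (4 * Real.pi * km) +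
      κ * (Rb * hH * e ^ 2 / r₀ ^ 2) with hCself
  refine ⟨Cself, max 4 (δ₀ ^ 2), by positivity, ?_⟩
  intro Γ θg p t γ α s₀ x hΓ hLmin hx ht hθg hθg1 hgp hsep j θ₁ hθ₁0 hθ₁h hθ₁A htilt hRbθ hγlo hγhi hα hq τ hτ hlow hhi
  -- Γ-level quantities
  have hΓ0 : 0 < Γ := by linarith
  set G := Real.sqrt Γ with hG
  have hG0 : 0 < G := Real.sqrt_pos.2 hΓ0
  have hG1 : 1 ≤ G := by rw [hG, ← Real.sqrt_one]; exact Real.sqrt_le_sqrt hΓ.le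
  have hGG : G ^ 2 = Γ := Real.sq_sqrt hΓ0.le
  set L := Real.log Γ with hL
  have hL4 : 4 ≤ L := (le_max_left _ _).trans hLmin
  have hL0 : 0 < L := by linarith
  have hδL : δ₀ ^ 2 ≤ L := (le_max_right _ _).trans hLmin
  set sL := Real.sqrt L with hsL
  have hsL0 : 0 < sL := Real.sqrt_pos.2 hL0
  have hsLL : sL ^ 2 = L := Real.sq_sqrt hL0.le
  have hsL1 : 1 ≤ sL := by rw [hsL, ← Real.sqrt_one]; exact Real.sqrt_le_sqrt (by linarith)
  have hδsL : δ₀ ≤ sL := by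
    have h := Real.sqrt_le_sqrt hδL
    rwa [Real.sqrt_sq hδ₀0.le] at h
  have hsqrtΓL : Real.sqrt (Γ * L) = G * sL := Real.sqrt_mul hΓ0.le L
  set ℓ := Rb * Real.sqrt (Γ * Real.log Γ) with hℓdef
  have hℓeq : ℓ = Rb * G * sL := by rw [hℓdef, ← hL, hsqrtΓL, mul_assoc]
  have hℓ0 : 0 < ℓ := by rw [hℓeq]; positivity
  have hℓne : ℓ ≠ 0 := hℓ0.ne'
  -- u and its bounds
  set u := G + |τ| with hu
  have hu0 : 0 < u := by positivity
  have hGu : G ≤ u := by rw [hu]; linarith [abs_nonneg τ]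
  have hτu : |τ| ≤ u := by rw [hu]; linarith
  have hucu : u ≤ cu * G * sL := by
    have h1 : G ≤ G * sL := le_mul_of_one_le_right hG0.le hsL1
    have hτ' : |τ| ≤ 3 * Rb * G * sL := hτ
    have heq : cu * G * sL = G * sL + 3 * Rb * G * sL := by rw [hcu]; ring
    rw [heq, hu]; linarith
  -- β, c and b
  set β := liaCoeff Γ γ j with hβ
  set c := Γ * γ j / (4 * Real.pi) with hc
  have hγj : 0 < |γ j| := hθp.trans_le hγlo
  have hγj' : γ j ≠ 0 := abs_pos.1 hγj
  have hβc : β = c * (L / 2) := by rw [hβ, hc, hL]; unfold liaCoeff; ring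
  set b : ℝ := 8 * Real.pi / (θp * Γ * L) with hb
  have hb0 : 0 < b := by positivity
  have hβinv : |β⁻¹| ≤ b := by
    rw [hβ, abs_inv]; unfold liaCoeff
    rw [hb, abs_div, abs_mul, abs_mul, abs_of_pos hΓ0, abs_of_pos hL0, abs_of_pos (by positivity : (0:ℝ) < 8 * Real.pi), inv_div]
    refine div_le_div_of_nonneg_left (by positivity) (by positivity) ?_
    calc θp * Γ * L = θp * (Γ * L) := by ring
      _ ≤ |γ j| * (Γ * L) := mul_le_mul_of_nonneg_right hγlo (by positivity)
      _ = Γ * |γ j| * L := by ring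
  set cΓ : ℝ := Γ / (4 * Real.pi * θp) with hcΓ
  have hγθ : ∀ k, |γ k| * θp ≤ 1 := fun k => by rw [← le_div_iff₀ hθp, one_div]; exact hγhi k
  have h4π : (0:ℝ) < 4 * Real.pi := by positivity
  have hcabs : |c| ≤ cΓ := by
    rw [hc, hcΓ, abs_div, abs_mul, abs_of_pos hΓ0, abs_of_pos h4π, div_le_div_iff₀ h4π (by positivity)]
    calc Γ * |γ j| * (4 * Real.pi * θp) = (|γ j| * θp) * (4 * Real.pi * Γ) := by ring
      _ ≤ 1 * (4 * Real.pi * Γ) := mul_le_mul_of_nonneg_right (hγθ j) (by positivity)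
      _ = Γ * (4 * Real.pi) := by ring
  have hcΓ0 : 0 ≤ cΓ := by positivity
  have hcb : cΓ * b = κ / L := by rw [hcΓ, hb, hκ]; field_simp; ring
  -- geometric quantities of the reference
  set Bd : ℝ := ∑ k ∈ Finset.univ.erase j, |Γ * γ k / (4 * Real.pi)| * (2 / (ρd / 2 * G)) with hBd
  have hBdle : Bd ≤ B₀ * G := by
    have hterm : ∀ k ∈ Finset.univ.erase j, |Γ * γ k / (4 * Real.pi)| * (2 / (ρd / 2 * G)) ≤ G / (Real.pi * θp * ρd) := by
      intro k _
      rw [abs_div, abs_mul, abs_of_pos hΓ0, abs_of_pos h4π, ← hGG]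
      have e1 : G ^ 2 * |γ k| / (4 * Real.pi) * (2 / (ρd / 2 * G)) = (|γ k| * θp) * (G / (Real.pi * θp * ρd)) := by
        first | (field_simp; ring) | field_simp
      rw [e1]
      calc (|γ k| * θp) * (G / (Real.pi * θp * ρd)) ≤ 1 * (G / (Real.pi * θp * ρd)) :=
            mul_le_mul_of_nonneg_right (hγθ k) (by positivity)
        _ = G / (Real.pi * θp * ρd) := one_mul _
    calc Bd ≤ N * (G / (Real.pi * θp * ρd)) := sum_erase_le_card_mul j (by positivity) hterm
      _ = B₀ * G := by rw [hB₀]; ring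
  have hBd0 : 0 ≤ Bd := Finset.sum_nonneg fun k _ => by positivity
  have hQ : 1 / 2 + |α| ≤ Q₀ := by rw [hQ₀]; linarith
  have hw : ‖waistPt Γ p t s₀ j‖ ≤ Rwd * G := by
    rw [waistPt_eq, norm_smul, Real.norm_of_nonneg hG0.le, mul_comm]; exact mul_le_mul_of_nonneg_right (hq j) hG0.le
  -- the collar floor: ℓ ≤ ‖x_j τ‖ ≤ Rwd√Γ + |τ| ≤ Cs (√Γ + |τ|)
  have hℓu : Rb * G * sL ≤ Cs * u := by
    have h1 : ℓ ≤ ‖x j τ‖ := by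
      have h := Real.sqrt_le_sqrt hlow
      rwa [Real.sqrt_sq hℓ0.le, Real.sqrt_sq (norm_nonneg _)] at h
    have h2 : ‖x j τ‖ ≤ ‖waistPt Γ p t s₀ j‖ + |τ| := hx.norm_le j τ
    have h3 : Rwd * G ≤ Rwd * u := mul_le_mul_of_nonneg_left hGu hRwd
    have heq : Cs * u = Rwd * u + u := by rw [hCs]; ring
    rw [← hℓeq, heq]; linarith
  -- the parameters of brick S4′
  set R := r₀ * G with hR
  have hR0 : 0 < R := by positivity
  set Lw := R + 2 * ℓ with hLw
  have hRL : R ≤ Lw := by rw [hLw]; linarith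
  set ε₀ := b * e₀ * G with hε₀
  set ε₁ := b * Q₀ with hε₁
  set κR := b * kR * u with hκR
  set κ0 := b * (e₀ + Q₀) * u with hκ0
  set H := b * hH with hHdef
  set H' := b * h' / G with hH'def
  set θ := 2 * θ₁ with hθ
  have hH0 : 0 ≤ H := by positivity
  have hH'0 : 0 ≤ H' := by positivity
  have hε₀' : |(liaCoeff Γ γ j)⁻¹| * (Bd + (1/2 + |α|) * ‖waistPt Γ p t s₀ j‖) ≤ ε₀ := by
    rw [← hβ, hε₀]
    have h2 : Bd + (1/2 + |α|) * ‖waistPt Γ p t s₀ j‖ ≤ e₀ * G := by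
      have hm := mul_le_mul hQ hw (norm_nonneg _) hQ₀0.le
      have heq : e₀ * G = B₀ * G + Q₀ * (Rwd * G) := by rw [he₀]; ring
      rw [heq]; linarith
    calc |β⁻¹| * (Bd + (1/2 + |α|) * ‖waistPt Γ p t s₀ j‖) ≤ b * (e₀ * G) :=
          mul_le_mul hβinv h2 (by positivity) hb0.le
      _ = b * e₀ * G := by ring
  have hε₁' : |(liaCoeff Γ γ j)⁻¹| * (1/2 + |α|) ≤ ε₁ := by
    rw [← hβ, hε₁]; exact mul_le_mul hβinv hQ (by positivity) hb0.le
  have hθ' : 2 * θ₁ ≤ θ := le_rfl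
  have hθ0 : 0 ≤ θ := by rw [hθ]; linarith
  have hθ1 : θ ≤ 1 := by rw [hθ]; linarith
  have hκR' : ε₀ + ε₁ * (|τ| + R) ≤ κR := by
    have hbe : b * e₀ * G ≤ b * e₀ * u := mul_le_mul_of_nonneg_left hGu (by positivity)
    have hbq : b * Q₀ * |τ| ≤ b * Q₀ * u := mul_le_mul_of_nonneg_left hτu (by positivity)
    have hbr : b * Q₀ * (r₀ * G) ≤ b * Q₀ * (r₀ * u) := mul_le_mul_of_nonneg_left (mul_le_mul_of_nonneg_left hGu hr₀0.le) (by positivity)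
    have heq : κR = b * e₀ * u + b * Q₀ * u + b * Q₀ * (r₀ * u) := by rw [hκR, hkR]; ring
    have heq2 : ε₀ + ε₁ * (|τ| + R) = b * e₀ * G + b * Q₀ * |τ| + b * Q₀ * (r₀ * G) := by rw [hε₀, hε₁, hR]; ring
    rw [heq, heq2]; linarith
  have hκ0' : ε₀ + ε₁ * |τ| ≤ κ0 := by
    have hbe : b * e₀ * G ≤ b * e₀ * u := mul_le_mul_of_nonneg_left hGu (by positivity)
    have hbq : b * Q₀ * |τ| ≤ b * Q₀ * u := mul_le_mul_of_nonneg_left hτu (by positivity)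
    have heq : κ0 = b * e₀ * u + b * Q₀ * u := by rw [hκ0]; ring
    have heq2 : ε₀ + ε₁ * |τ| = b * e₀ * G + b * Q₀ * |τ| := by rw [hε₀, hε₁]
    rw [heq, heq2]; linarith
  have hκRR : κR * R ≤ δ₀ / sL := by
    have h1 : κR * R ≤ b * kR * (cu * G * sL) * (r₀ * G) := by
      rw [hκR, hR]; exact mul_le_mul_of_nonneg_right (mul_le_mul_of_nonneg_left hucu (by positivity)) (by positivity)
    have h2 : b * kR * (cu * G * sL) * (r₀ * G) = δ₀ / sL := by
      rw [hb, hδ₀, eq_div_iff hsL0.ne', ← hGG, ← hsLL]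
      first | (field_simp; ring) | field_simp
    rw [← h2]; exact h1
  have hsmall : κR * R ≤ 1 := by
    refine hκRR.trans ?_
    rw [div_le_one hsL0]; exact hδsL
  have hκRR2 : (κR * R) ^ 2 ≤ (δ₀ / sL) ^ 2 := pow_le_pow_left₀ (by positivity) hκRR 2
  -- the window data of x‴ from brick S4′c
  have htilt' : ∀ σ, ‖deriv (x j) σ - t j‖ ≤ θ₁ := fun σ => (htilt σ).trans hRbθ
  have hZH : ∀ r, |r - τ| ≤ R →
      ‖((liaCoeff Γ γ j)⁻¹ * (deriv Real.smoothTransition (1 - (‖x j r‖ ^ 2 / (Rb * Real.sqrt (Γ * Real.log Γ)) ^ 2 + 1 - 2 * (3 / 2 : ℝ))) *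
            (-(2 * ⟪x j r, deriv (x j) r⟫_ℝ / (Rb * Real.sqrt (Γ * Real.log Γ)) ^ 2)))) •
          cross (deriv (x j) r) (ambientField Γ p t γ α s₀ j (x j r)) +
        ((liaCoeff Γ γ j)⁻¹ * refCutoff (Rb * Real.sqrt (Γ * Real.log Γ)) (x j r)) •
          (cross (deriv (x j) r) (fderiv ℝ (ambientField Γ p t γ α s₀ j) (x j r) (deriv (x j) r)) +
            cross (deriv (deriv (x j)) r) (ambientField Γ p t γ α s₀ j (x j r)))‖ ≤ H :=
    fun r hr => (hwin hΓ hL4 hx ht hθg hθg1 hgp hsep j hθ₁0 hθ₁A htilt' hγlo hγhi hα hq hτ r hr).1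
  have hZlip : ∀ r, |r - τ| ≤ R →
      ‖(((liaCoeff Γ γ j)⁻¹ * (deriv Real.smoothTransition (1 - (‖x j r‖ ^ 2 / (Rb * Real.sqrt (Γ * Real.log Γ)) ^ 2 + 1 - 2 * (3 / 2 : ℝ))) *
            (-(2 * ⟪x j r, deriv (x j) r⟫_ℝ / (Rb * Real.sqrt (Γ * Real.log Γ)) ^ 2)))) •
          cross (deriv (x j) r) (ambientField Γ p t γ α s₀ j (x j r)) +
        ((liaCoeff Γ γ j)⁻¹ * refCutoff (Rb * Real.sqrt (Γ * Real.log Γ)) (x j r)) •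
          (cross (deriv (x j) r) (fderiv ℝ (ambientField Γ p t γ α s₀ j) (x j r) (deriv (x j) r)) +
            cross (deriv (deriv (x j)) r) (ambientField Γ p t γ α s₀ j (x j r)))) -
        (((liaCoeff Γ γ j)⁻¹ * (deriv Real.smoothTransition (1 - (‖x j τ‖ ^ 2 / (Rb * Real.sqrt (Γ * Real.log Γ)) ^ 2 + 1 - 2 * (3 / 2 : ℝ))) *
            (-(2 * ⟪x j τ, deriv (x j) τ⟫_ℝ / (Rb * Real.sqrt (Γ * Real.log Γ)) ^ 2)))) •
          cross (deriv (x j) τ) (ambientField Γ p t γ α s₀ j (x j τ)) +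
        ((liaCoeff Γ γ j)⁻¹ * refCutoff (Rb * Real.sqrt (Γ * Real.log Γ)) (x j τ)) •
          (cross (deriv (x j) τ) (fderiv ℝ (ambientField Γ p t γ α s₀ j) (x j τ) (deriv (x j) τ)) +
            cross (deriv (deriv (x j)) τ) (ambientField Γ p t γ α s₀ j (x j τ))))‖ ≤ H' * |r - τ| :=
    fun r hr => (hwin hΓ hL4 hx ht hθg hθg1 hgp hsep j hθ₁0 hθ₁A htilt' hγlo hγhi hα hq hτ r hr).2
  -- brick S4′
  have h4 := hx.selfDerivStrand_sub_lia_le ht hθg hθg1 hgp hρ hsep hΓ0 hℓ0 j hθ₁0 hθ₁A htilt' he0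
    hR0 hRL hε₀' hε₁' hθ' hθ1 hκR' hκ0' hsmall hH0 hH'0 hZH hZlip
  -- the Rosenhead coefficient against liaCoeff
  set Λ : ℝ := Real.arsinh (R / e) - R / Real.sqrt (R ^ 2 + e ^ 2) with hΛ
  simp only [he2] at h4
  have hΛ0 : 0 ≤ Λ := liaWindowCoeff_nonneg he0 hR0.le
  have h2e : 2 < Real.exp 1 := by have h := Real.add_one_lt_exp (one_ne_zero (α := ℝ)); linarith only [h]
  have heR : e ≤ R := by
    rw [hR, hr₀]
    have h1 : 1 ≤ Real.exp 1 / 2 * G := one_le_mul_of_one_le_of_one_le (by linarith only [h2e]) hG1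
    calc e = e * 1 := (mul_one e).symm
      _ ≤ e * (Real.exp 1 / 2 * G) := mul_le_mul_of_nonneg_left h1 he0.le
      _ = e * Real.exp 1 / 2 * G := by ring
  have hΛL : |Λ - L / 2| ≤ e ^ 2 / R ^ 2 := by
    have h := abs_liaWindowCoeff_sub_log_le he0 heR
    have hlog : Real.log (2 * R / e) - 1 = L / 2 := by
      rw [hR, hr₀, show 2 * (e * Real.exp 1 / 2 * G) / e = Real.exp 1 * G by field_simp, Real.log_mul (Real.exp_pos 1).ne' hG0.ne',
        Real.log_exp, hG, Real.log_sqrt hΓ0.le, hL]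
      ring
    rwa [hlog] at h
  have hΛle : Λ ≤ L := by
    have h1 : Λ ≤ L / 2 + e ^ 2 / R ^ 2 := by have h := (abs_le.1 hΛL).2; linarith only [h]
    have h2 : e ^ 2 / R ^ 2 ≤ 1 := by rw [div_le_one (by positivity)]; exact pow_le_pow_left₀ he0.le heR 2
    linarith only [h1, h2, hL4]
  clear_value Λ
  -- the switched-region form of the V-term: x′ × x‴ (refCutoff = 1, χ′ = 0 on ‖x_jτ‖² ≤ 2ℓ²), x″ × x″ = 0
  set Zτ : EuclideanSpace ℝ (Fin 3) :=
    (β⁻¹ * (deriv Real.smoothTransition (1 - (‖x j τ‖ ^ 2 / ℓ ^ 2 + 1 - 2 * (3 / 2 : ℝ))) *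
          (-(2 * ⟪x j τ, deriv (x j) τ⟫_ℝ / ℓ ^ 2)))) •
        cross (deriv (x j) τ) (ambientField Γ p t γ α s₀ j (x j τ)) +
      (β⁻¹ * refCutoff ℓ (x j τ)) •
        (cross (deriv (x j) τ) (fderiv ℝ (ambientField Γ p t γ α s₀ j) (x j τ) (deriv (x j) τ)) +
          cross (deriv (deriv (x j)) τ) (ambientField Γ p t γ α s₀ j (x j τ))) with hZτdef
  have hhi2 : ‖x j τ‖ ^ 2 ≤ 2 * ℓ ^ 2 := hhi
  have hZτeq : Zτ = β⁻¹ • (cross (deriv (x j) τ) (fderiv ℝ (ambientField Γ p t γ α s₀ j) (x j τ) (deriv (x j) τ)) +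
      cross (deriv (deriv (x j)) τ) (ambientField Γ p t γ α s₀ j (x j τ))) := by
    rw [hZτdef]
    exact thirdDerivForm_eq_of_sq_le hℓne hhi2 β⁻¹ (-(2 * ⟪x j τ, deriv (x j) τ⟫_ℝ / ℓ ^ 2))
      (cross (deriv (x j) τ) (ambientField Γ p t γ α s₀ j (x j τ))) _
  have hcs : cross (deriv (deriv (x j)) τ) (deriv (deriv (x j)) τ) = 0 := by simp [cross]
  set X : EuclideanSpace ℝ (Fin 3) := cross (deriv (x j) τ) Zτ with hX
  have hV : cross (deriv (x j) τ) (β⁻¹ • (cross (deriv (deriv (x j)) τ) (ambientField Γ p t γ α s₀ j (x j τ)) +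
        cross (deriv (x j) τ) (fderiv ℝ (ambientField Γ p t γ α s₀ j) (x j τ) (deriv (x j) τ)))) +
      cross (deriv (deriv (x j)) τ) (deriv (deriv (x j)) τ) = X := by
    rw [hcs, add_zero, hX, hZτeq, add_comm (cross (deriv (deriv (x j)) τ) (ambientField Γ p t γ α s₀ j (x j τ)))]
  have hXle : ‖X‖ ≤ H := by
    have hττ : |τ - τ| ≤ R := by rw [sub_self, abs_zero]; exact hR0.le
    have hZτH : ‖Zτ‖ ≤ H := hZH τ hττ
    have h := norm_cross_le_norm_mul_norm (deriv (x j) τ) Zτ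
    rw [(hx j).2.1 τ, one_mul] at h
    exact h.trans hZτH
  -- split `c • S − β • X = c • (S − Λ • X) + (c Λ − β) • X`
  set S := ∫ σ : ℝ, ((-3 * ⟪x j τ - x j σ, deriv (x j) τ⟫_ℝ * ((‖x j τ - x j σ‖ ^ 2 + a₀) ^ (5 / 2 : ℝ))⁻¹) •
      cross (deriv (x j) σ) (x j τ - x j σ) + ((‖x j τ - x j σ‖ ^ 2 + a₀) ^ (3 / 2 : ℝ))⁻¹ • cross (deriv (x j) σ) (deriv (x j) τ)) with hS
  set κm : ℝ := |β⁻¹| * (Bd + (1 / 2 + |α|) * (Real.sqrt 3 * ℓ)) with hκmdef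
  have hsplit : c • S - β • X = c • (S - Λ • X) + (c * Λ - β) • X := by
    rw [smul_sub, sub_smul, smul_smul]; abel
  have hcoef : |c * Λ - β| ≤ cΓ * (e ^ 2 / R ^ 2) := by
    rw [hβc, show c * Λ - c * (L / 2) = c * (Λ - L / 2) by ring, abs_mul]
    exact mul_le_mul hcabs hΛL (abs_nonneg _) (by positivity)
  rw [hV]
  change ℓ * ‖c • S - β • X‖ ≤ Cself * u / sL
  rw [hsplit]
  set BND : ℝ := 2 * R * (8 * H' + 84 * (κR * H)) + 8 * (κR * R) ^ 2 * H * Λ + 72 * ε₁ * Real.log (Lw / R) + 72 * Real.pi * κ0 / R +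
      (64 * θ / Lw + 8 * κm) * (Real.pi / Lw) with hBND
  have h4' : ‖S - Λ • X‖ ≤ BND := h4
  have hmain : ‖c • (S - Λ • X) + (c * Λ - β) • X‖ ≤ cΓ * BND + cΓ * (e ^ 2 / R ^ 2) * H := by
    refine (norm_add_le _ _).trans (add_le_add ?_ ?_)
    · rw [norm_smul, Real.norm_eq_abs]; exact mul_le_mul hcabs h4' (norm_nonneg _) hcΓ0
    · rw [norm_smul, Real.norm_eq_abs]; exact mul_le_mul hcoef hXle (norm_nonneg _) (by positivity)
  -- inputs of the eight terms
  have hLwℓ : 2 * ℓ ≤ Lw := by rw [hLw]; linarith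
  have hlogLw : Real.log (Lw / R) ≤ 2 * Rb * sL / r₀ := by
    have hpos : 0 < Lw / R := by positivity
    have h := Real.log_le_sub_one_of_pos hpos
    have h2 : Lw / R - 1 = 2 * Rb * sL / r₀ := by rw [hLw, hR, hℓeq]; first | (field_simp; ring) | field_simp
    linarith only [h, h2]
  have hκm0 : 0 ≤ κm := by positivity
  have hκmle : κm ≤ b * km * G * sL := by
    have h3 : Real.sqrt 3 ≤ 2 := by
      rw [show (2:ℝ) = Real.sqrt 4 by rw [show (4:ℝ) = 2 ^ 2 by norm_num, Real.sqrt_sq (by norm_num)]]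
      exact Real.sqrt_le_sqrt (by norm_num)
    have h1 : Bd ≤ B₀ * G * sL := hBdle.trans (by rw [mul_assoc]; exact mul_le_mul_of_nonneg_left (le_mul_of_one_le_right hG0.le hsL1) hB₀0)
    have h2 : (1 / 2 + |α|) * (Real.sqrt 3 * ℓ) ≤ Q₀ * (2 * ℓ) :=
      mul_le_mul hQ (mul_le_mul_of_nonneg_right h3 hℓ0.le) (by positivity) hQ₀0.le
    have hin : Bd + (1 / 2 + |α|) * (Real.sqrt 3 * ℓ) ≤ km * G * sL := by
      have heq : km * G * sL = B₀ * G * sL + Q₀ * (2 * (Rb * G * sL)) := by rw [hkm]; ring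
      rw [heq, ← hℓeq]; linarith
    calc κm ≤ b * (km * G * sL) := mul_le_mul hβinv hin (by positivity) hb0.le
      _ = b * km * G * sL := by ring
  -- the eight terms
  have T1 := selfDerivTerm_T1 (cΓ := cΓ) (u := u) hcb hsLL hsL1 hG0 hGu hκpos.le hr₀0.le hh'0 hRb.le hℓeq hR hH'def
  have T2 := selfDerivTerm_T2 (cΓ := cΓ) hcb hb hsLL hGG hsL1 hG0 hGu hθp hκpos.le hr₀0.le hkR0.le hhH0 hRb.le hℓeq hR hκR hHdef
  have T3 := selfDerivTerm_T3 (cΓ := cΓ) hcb hsLL hsL1 hG0 hGu hκpos.le hcΓ0 hb0.le hhH0 hRb.le hκRR2 hΛ0 hΛle hℓeq hHdef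
  have T4 := selfDerivTerm_T4 (cΓ := cΓ) (lg := Real.log (Lw / R)) hcb hsLL hsL1 hG0 hκpos.le hcΓ0 hb0.le hQ₀0.le hr₀0 hRb.le hlogLw hℓeq hℓu hε₁
  have T5 := selfDerivTerm_T5 (cΓ := cΓ) (κ := κ) hcb hsLL hsL1 hG0 hr₀0 hℓeq hR hκ0
  have T6 := selfDerivTerm_T6 (cΓ := cΓ) (u := u) hcΓ hGG hsL1 hG0 hGu hθp hRb hθ1 hℓeq hLwℓ
  have T7 := selfDerivTerm_T7 (cΓ := cΓ) hcb hsLL hsL1 hG0 hGu hκpos.le hcΓ0 hb0.le hkm0 hκmle hRb hℓeq hLwℓ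
  have T8 := selfDerivTerm_T8 (cΓ := cΓ) (e := e) hcb hsLL hsL1 hG1 hGu hκpos.le hhH0 hRb.le hr₀0 hℓeq hR hHdef
  have htot : ℓ * (cΓ * BND + cΓ * (e ^ 2 / R ^ 2) * H) =
      ℓ * cΓ * (16 * R * H') + ℓ * cΓ * (168 * R * (κR * H)) + ℓ * cΓ * (8 * (κR * R) ^ 2 * H * Λ) +
        ℓ * cΓ * (72 * ε₁ * Real.log (Lw / R)) + ℓ * cΓ * (72 * Real.pi * κ0 / R) + ℓ * cΓ * (64 * θ / Lw * (Real.pi / Lw)) +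
        ℓ * cΓ * (8 * κm * (Real.pi / Lw)) + ℓ * (cΓ * (e ^ 2 / R ^ 2) * H) := by
    rw [hBND]; ring
  have hfinal : κ * (16 * r₀ * Rb * h') * (u / sL) + κ * (1344 * Real.pi * r₀ * Rb * kR * hH / θp) * (u / sL) +
      κ * (8 * δ₀ ^ 2 * hH * Rb) * (u / sL) + κ * (144 * Q₀ * Rb * Cs / r₀) * (u / sL) + κ * (72 * Real.pi * Rb * (e₀ + Q₀) / r₀) * (u / sL) +
      4 / (θp * Rb) * (u / sL) + κ * (4 * Real.pi * km) * (u / sL) + κ * (Rb * hH * e ^ 2 / r₀ ^ 2) * (u / sL) = Cself * u / sL := by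
    rw [hCself]; ring
  calc ℓ * ‖c • (S - Λ • X) + (c * Λ - β) • X‖ ≤ ℓ * (cΓ * BND + cΓ * (e ^ 2 / R ^ 2) * H) := mul_le_mul_of_nonneg_left hmain hℓ0.le
    _ ≤ Cself * u / sL := by rw [htot]; linarith only [T1, T2, T3, T4, T5, T6, T7, T8, hfinal.le, hfinal.ge]

end Summit.NavierStokesRegularity.NavierStokesRegularity.Theorems.SkeletonJ1RFrame

end
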